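import Literature.AlgebraicGeometry.Resolution.Lemma411OffVertex
import Literature.AlgebraicGeometry.Resolution.AlterationsLemma411SmoothLocus
import Literature.AlgebraicGeometry.Resolution.AlterationsLemma411
import Literature.AlgebraicGeometry.Resolution.SmoothOfRegularFibre
import Literature.AlgebraicGeometry.Resolution.ProjectiveSpaceRegular
import Literature.AlgebraicGeometry.Resolution.AlterationsBoundarySmoothLocus
import Literature.AlgebraicGeometry.Resolution.AlterationsMultisectionEtaleNhdLemmas
import Literature.AlgebraicGeometry.Resolution.AlterationsDescentLimit
import Literature.AlgebraicGeometry.Morphisms.SmoothOfFlatFibre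
import Literature.AlgebraicGeometry.Motives.ProjectiveNoetherNormalization
import Literature.RingTheory.Flat.RegularFibreFlat
import HarnessLib

/-!
# A smooth fibre of the fibration of Lemma 4.11 from regular points of one curve

Topic: `Literature/AlgebraicGeometry/Resolution`. De Jong 1996, proof of Lemma 4.11, the case
"`X` normal": "By Bertini's theorem we may choose […] such that the general fibre of `f` is
smooth" — conclusion (vi) c') of 4.12 / the clause `Smooth (f.fiberToSpecResidueField y)` of the
open leaf `DeJong1996Lemma411VertexChoice`. For `π : X → ℙ^{d+1}_k` (`k` algebraically
closed, `X` integral proper of dimension `d + 1`), `(P̃, b, q)` the blowing up of the vertex with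
its smooth projection `q`, `X' = X ×_{ℙ^{d+1}} P̃` and `f = pr₂ ≫ q : X' → ℙ^d`, this file
reduces the smoothness of the fibre of `f` over a closed point `y₀ ∈ ℙ^d` to the smoothness of
`pr ∘ π` at the closed points `x` of `X` off the vertex with `pr(π(x)) = y₀`, and proves the
latter from the regularity of a one-dimensional quotient of `𝒪_{X,x}`:

* `mem_smoothLocus_of_flat_of_isRegularLocalRing_quotient` — **Stacks 01V8 at one point**:
  `f` locally of finite presentation over a locally Noetherian base, `𝒪_{Y,f x} → 𝒪_{X,x}` flat
  with regular fibre ring `𝒪_{X,x}/𝔪_{f x}𝒪_{X,x}` and `κ(f x)` perfect ⇒ `x ∈ sm(f)`;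
* `DeJong1996.mem_smoothLocus_offVertexProjection` — **`pr ∘ π : X° → ℙ^d` is smooth at a closed
  point `x` with `𝒪_{X,x}/𝔪_y𝒪_{X,x}` regular of dimension `≤ 1`** (Matsumura 23.1: flat over
  the regular `𝒪_{ℙ^d,y}` of dimension `d` since `dim 𝒪_{X,x} = d + 1`), the ideal
  `𝔪_y𝒪_{X,x}` being presented by generators `γᵢ` of `𝔪_y` and their pull-backs `gᵢ ∈ 𝒪_{X,x}`;
* `DeJong1996.mem_smoothLocus_fibration_of_mem_offVertex` — off the exceptional locus
  `f = (pr ∘ π) ∘ φ` with `φ` an isomorphism there, so smooth points correspond;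
* `DeJong1996.smooth_fiberToSpecResidueField_fibration` — **the fibre of `f` over the closed
  point `y₀` is smooth** as soon as `pr ∘ π` is smooth at every closed point of `X°` over `y₀`:
  points of `X'` over the vertex are smooth points of `f` (`π` étale over a neighbourhood of the
  vertex, `q` smooth: `DeJong1996.mem_smoothLocus_of_apply_mem`), non-closed points of the fibre
  specialise to closed ones, and `f` is proper (`exists_smooth_morphismRestrict_of_forall_mem_smoothLocus`).

Everything is proved; no named facts.

## References

* A. J. de Jong, *Smoothness, semi-stability and alterations*, Publ. Math. IHÉS 83 (1996),
  proof of Lemma 4.11, p. 68; 4.12 (vi) c'). [DeJong1996]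
* H. Matsumura, *Commutative Ring Theory* (1986), Thm. 23.1. [Matsumura1987]
* The Stacks Project, Tag 01V8. [StacksProject]
-/

noncomputable section

open CategoryTheory CategoryTheory.Limits AlgebraicGeometry TopologicalSpace Topology IsLocalRing
  TensorProduct
open Literature.AlgebraicGeometry.Motives
open Literature.AlgebraicGeometry.Motives.Segre (grading toSpec)
open Scheme.IdealSheafData

attribute [local instance] MvPolynomial.gradedAlgebra

namespace Literature.AlgebraicGeometry.Resolution

universe u

/-! ## Stacks 01V8 at one point -/

/-- **A point with flat local map and regular fibre ring is a smooth point** (Stacks 01V8 /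
EGA IV₄ 17.5.1, pointwise): `f : X → Y` locally of finite presentation, `Y` locally Noetherian,
`𝒪_{Y,f x} → 𝒪_{X,x}` flat, `𝒪_{X,x}/𝔪_{f x}𝒪_{X,x}` a regular local ring and `κ(f x)` perfect;
then `x ∈ sm(X/Y)`. (The fibre ring is `κ(f x) ⊗ 𝒪_{X,x}`, essentially of finite type over the
perfect `κ`, hence formally smooth, and `formallySmooth_of_flat_of_isRegularLocalRing_fiber`
applies.) [cite: StacksProject, Tag 01V8] -/
theorem mem_smoothLocus_of_flat_of_isRegularLocalRing_quotient {X Y : Scheme.{u}} (f : X ⟶ Y)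
    [LocallyOfFinitePresentation f] [IsLocallyNoetherian Y] (x : X)
    [PerfectField (Y.residueField (f x))] (hflat : (f.stalkMap x).hom.Flat)
    (hreg : IsRegularLocalRing (X.presheaf.stalk x ⧸
      (maximalIdeal (Y.presheaf.stalk (f x))).map (f.stalkMap x).hom)) :
    x ∈ f.smoothLocus := by
  set R := Y.presheaf.stalk (f x) with hR
  set S := X.presheaf.stalk x with hS
  letI : Algebra R S := (f.stalkMap x).hom.toAlgebra
  haveI : IsLocalHom (algebraMap R S) := inferInstanceAs (IsLocalHom (f.stalkMap x).hom)
  haveI : Algebra.EssFiniteType R S := LocallyOfFiniteType.stalkMap f x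
  haveI : Module.Flat R S := hflat
  haveI : PerfectField (ResidueField R) := inferInstanceAs (PerfectField (Y.residueField (f x)))
  have e₁ : (S ⧸ (maximalIdeal R).map (algebraMap R S)) ≃+* ResidueField R ⊗[R] S :=
    (Algebra.TensorProduct.quotIdealMapEquivTensorQuot S (maximalIdeal R)).toRingEquiv.trans
      (Algebra.TensorProduct.comm R S (ResidueField R)).toRingEquiv
  have hreg' : IsRegularLocalRing (ResidueField R ⊗[R] S) :=
    @IsRegularLocalRing.of_ringEquiv _ _ hreg _ _ e₁
  have hfs : Algebra.FormallySmooth R S :=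
    formallySmooth_of_flat_of_isRegularLocalRing_fiber R S hreg'
  rw [Scheme.Hom.mem_smoothLocus]
  exact hfs

namespace DeJong1996

variable {k : Type u} [Field k] (d : ℕ)

/-! ## `pr ∘ π` is locally of finite presentation -/

section FinitePresentation

variable (k) {X : Scheme.{u}} (π : X ⟶ Proj (grading (Fin (d + 1 + 1)) k))

/-- `pr ∘ π : X° → ℙ^d` is locally of finite type when `X` is of finite type over `k`.
[folklore] -/
theorem locallyOfFiniteType_offVertexProjection
    [LocallyOfFiniteType (π ≫ toSpec (Fin (d + 1 + 1)) k)] :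
    LocallyOfFiniteType (offVertexProjection d k π) := by
  have h : LocallyOfFiniteType (offVertexProjection d k π ≫ toSpec (Fin (d + 1)) k) := by
    rw [offVertexProjection_toSpec]; infer_instance
  exact locallyOfFiniteType_of_comp _ (toSpec (Fin (d + 1)) k)

/-- `pr ∘ π : X° → ℙ^d` is locally of finite presentation when `X` is of finite type over `k`.
[folklore] -/
theorem locallyOfFinitePresentation_offVertexProjection
    [LocallyOfFiniteType (π ≫ toSpec (Fin (d + 1 + 1)) k)] :
    LocallyOfFinitePresentation (offVertexProjection d k π) := by
  haveI := locallyOfFiniteType_offVertexProjection k d π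
  haveI : IsProper (toSpec (Fin (d + 1)) k) := ProjSpace.isProper_over d k
  haveI : IsLocallyNoetherian (Proj (grading (Fin (d + 1)) k)) :=
    LocallyOfFiniteType.isLocallyNoetherian (toSpec (Fin (d + 1)) k)
  exact Descent45.Setup.locallyOfFinitePresentation_of_isLocallyNoetherian _

end FinitePresentation

/-! ## `pr ∘ π` is smooth at a closed point with regular one-dimensional fibre ring -/

section OffVertexPoint

variable [IsAlgClosed k] {X : Scheme.{u}} [IsIntegral X] (π : X ⟶ Proj (grading (Fin (d + 1 + 1)) k))
  (fX : X ⟶ Spec (.of k)) (hdim : topologicalKrullDim X = (d + 1 : ℕ))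

include hdim in
set_option maxHeartbeats 400000 in
/-- **`pr ∘ π : X° → ℙ^d` is smooth at a closed point `x` whose fibre ring is regular of
dimension `≤ 1`.** Here `X` is integral of finite type over the algebraically closed `k` with
`dim X = d + 1`, `x ∈ X° = π⁻¹(ℙ^{d+1} ∖ {vertex})` is closed in `X` with closed image
`y = pr(π(x)) ∈ ℙ^d`, the maximal ideal `𝔪_y` is generated by germs `γᵢ` whose pull-backs are the
images in `𝒪_{X°,x} ≅ 𝒪_{X,x}` of elements `gᵢ ∈ 𝒪_{X,x}`, and `𝒪_{X,x}/(gᵢ)ᵢ` is a regular local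
ring of dimension `≤ 1`. Then `𝒪_{ℙ^d,y} → 𝒪_{X,x}` is flat (Matsumura 23.1 over the regular
`𝒪_{ℙ^d,y}` of dimension `d`, as `dim 𝒪_{X,x} = d + 1`) with regular fibre, so `x ∈ sm(pr ∘ π)`
(Stacks 01V8). [cite: DeJong1996, Lemma 4.11 (proof), p. 68] [cite: Matsumura1987, Thm. 23.1]
[cite: StacksProject, Tag 01V8] -/
theorem mem_smoothLocus_offVertexProjection [LocallyOfFiniteType fX]
    [LocallyOfFinitePresentation (offVertexProjection d k π)] (x : ↥(offVertex d k π))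
    (hxc : IsClosed ({(offVertex d k π).ι x} : Set X))
    (hyc : IsClosed ({offVertexProjection d k π x} : Set (Proj (grading (Fin (d + 1)) k))))
    {ι' : Type*} (γ : ι' → (Proj (grading (Fin (d + 1)) k)).presheaf.stalk (offVertexProjection d k π x))
    (hγ : Ideal.span (Set.range γ) =
      maximalIdeal ((Proj (grading (Fin (d + 1)) k)).presheaf.stalk (offVertexProjection d k π x)))
    (g : ι' → X.presheaf.stalk ((offVertex d k π).ι x))
    (hg : ∀ i, ((offVertexProjection d k π).stalkMap x).hom (γ i) =
      (((offVertex d k π).ι).stalkMap x).hom (g i))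
    (hreg : IsRegularLocalRing (X.presheaf.stalk ((offVertex d k π).ι x) ⧸ Ideal.span (Set.range g)))
    (hdim1 : ringKrullDim (X.presheaf.stalk ((offVertex d k π).ι x) ⧸ Ideal.span (Set.range g)) ≤ 1) :
    x ∈ (offVertexProjection d k π).smoothLocus := by
  haveI : IsProper (toSpec (Fin (d + 1)) k) := ProjSpace.isProper_over d k
  haveI : IsLocallyNoetherian X := LocallyOfFiniteType.isLocallyNoetherian fX
  haveI : IsLocallyNoetherian (Proj (grading (Fin (d + 1)) k)) :=
    LocallyOfFiniteType.isLocallyNoetherian (toSpec (Fin (d + 1)) k)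
  -- the rings `A = 𝒪_{ℙ^d,y}`, `S = 𝒪_{X°,x} ≅ B = 𝒪_{X,x}` (not abbreviated: `g`, `γ` depend on them)
  let e : X.presheaf.stalk ((offVertex d k π).ι x) ≃+* (offVertex d k π : Scheme.{u}).presheaf.stalk x :=
    (asIso (((offVertex d k π).ι).stalkMap x)).commRingCatIsoToRingEquiv
  -- `A` is regular of dimension `d`
  haveI : IsRegularLocalRing ((Proj (grading (Fin (d + 1)) k)).presheaf.stalk (offVertexProjection d k π x)) :=
    isRegular_projectiveSpace (n := d) (k := k) _
  have hdimA : ringKrullDim ((Proj (grading (Fin (d + 1)) k)).presheaf.stalk (offVertexProjection d k π x)) = d := by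
    rw [ringKrullDim_stalk_eq_of_isClosed (toSpec (Fin (d + 1)) k) hyc, ProjSpace.topologicalKrullDim_eq]
  -- `dim S = dim B = d + 1`
  have hdimB : ringKrullDim (X.presheaf.stalk ((offVertex d k π).ι x)) = (d + 1 : ℕ) := by
    rw [ringKrullDim_stalk_eq_of_isClosed fX hxc, hdim]
  have hdimS : ringKrullDim ((offVertex d k π : Scheme.{u}).presheaf.stalk x) = (d + 1 : ℕ) := by
    rw [← hdimB]; exact (ringKrullDim_eq_of_ringEquiv e).symm
  -- the fibre ideal `𝔪_A S = e((gᵢ)ᵢ)`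
  letI : Algebra ((Proj (grading (Fin (d + 1)) k)).presheaf.stalk (offVertexProjection d k π x))
      ((offVertex d k π : Scheme.{u}).presheaf.stalk x) :=
    ((offVertexProjection d k π).stalkMap x).hom.toAlgebra
  haveI : IsLocalHom (algebraMap ((Proj (grading (Fin (d + 1)) k)).presheaf.stalk (offVertexProjection d k π x))
      ((offVertex d k π : Scheme.{u}).presheaf.stalk x)) :=
    inferInstanceAs (IsLocalHom ((offVertexProjection d k π).stalkMap x).hom)
  have hI : (maximalIdeal ((Proj (grading (Fin (d + 1)) k)).presheaf.stalk (offVertexProjection d k π x))).map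
      (algebraMap _ ((offVertex d k π : Scheme.{u}).presheaf.stalk x)) =
      (Ideal.span (Set.range g)).map (e : X.presheaf.stalk ((offVertex d k π).ι x) →+* _) := by
    have hcomp : (⇑(algebraMap _ ((offVertex d k π : Scheme.{u}).presheaf.stalk x)) ∘ γ) =
        (⇑(e : X.presheaf.stalk ((offVertex d k π).ι x) →+* _) ∘ g) := funext fun i => hg i
    rw [← hγ, Ideal.map_span, Ideal.map_span, ← Set.range_comp, ← Set.range_comp, hcomp]
  -- `S/𝔪_A S ≅ B/(gᵢ)ᵢ` is regular of dimension `≤ 1`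
  let eq : (X.presheaf.stalk ((offVertex d k π).ι x) ⧸ Ideal.span (Set.range g)) ≃+*
      (offVertex d k π : Scheme.{u}).presheaf.stalk x ⧸
        (maximalIdeal ((Proj (grading (Fin (d + 1)) k)).presheaf.stalk (offVertexProjection d k π x))).map
          (algebraMap _ ((offVertex d k π : Scheme.{u}).presheaf.stalk x)) :=
    Ideal.quotientEquiv (Ideal.span (Set.range g)) _ e hI
  have hF : IsRegularLocalRing ((offVertex d k π : Scheme.{u}).presheaf.stalk x ⧸
      (maximalIdeal ((Proj (grading (Fin (d + 1)) k)).presheaf.stalk (offVertexProjection d k π x))).map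
        (algebraMap _ ((offVertex d k π : Scheme.{u}).presheaf.stalk x))) :=
    @IsRegularLocalRing.of_ringEquiv _ _ hreg _ _ eq
  have h1 : ringKrullDim ((offVertex d k π : Scheme.{u}).presheaf.stalk x ⧸
      (maximalIdeal ((Proj (grading (Fin (d + 1)) k)).presheaf.stalk (offVertexProjection d k π x))).map
        (algebraMap _ ((offVertex d k π : Scheme.{u}).presheaf.stalk x))) ≤ 1 := by
    rw [← ringKrullDim_eq_of_ringEquiv eq]; exact hdim1
  have hle : ringKrullDim ((Proj (grading (Fin (d + 1)) k)).presheaf.stalk (offVertexProjection d k π x)) +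
      ringKrullDim ((offVertex d k π : Scheme.{u}).presheaf.stalk x ⧸
        (maximalIdeal ((Proj (grading (Fin (d + 1)) k)).presheaf.stalk (offVertexProjection d k π x))).map
          (algebraMap _ ((offVertex d k π : Scheme.{u}).presheaf.stalk x))) ≤
      ringKrullDim ((offVertex d k π : Scheme.{u}).presheaf.stalk x) := by
    rw [hdimA, hdimS]
    calc (d : WithBot ℕ∞) + ringKrullDim ((offVertex d k π : Scheme.{u}).presheaf.stalk x ⧸
          (maximalIdeal ((Proj (grading (Fin (d + 1)) k)).presheaf.stalk (offVertexProjection d k π x))).map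
            (algebraMap _ ((offVertex d k π : Scheme.{u}).presheaf.stalk x)))
        ≤ (d : WithBot ℕ∞) + 1 := add_le_add le_rfl h1
      _ = ((d + 1 : ℕ) : WithBot ℕ∞) := by push_cast; rfl
  -- flat by Matsumura 23.1
  have hflat : Module.Flat ((Proj (grading (Fin (d + 1)) k)).presheaf.stalk (offVertexProjection d k π x))
      ((offVertex d k π : Scheme.{u}).presheaf.stalk x) :=
    Literature.RingTheory.Flat.flat_of_isRegularLocalRing_of_isRegularLocalRing_fiber hF hle
  -- perfect residue field at the closed point `y`
  haveI : IsAlgClosed ((Proj (grading (Fin (d + 1)) k)).residueField (offVertexProjection d k π x)) :=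
    isAlgClosed_residueField_of_isClosed (toSpec (Fin (d + 1)) k) hyc
  exact mem_smoothLocus_of_flat_of_isRegularLocalRing_quotient (offVertexProjection d k π) x hflat hF

end OffVertexPoint

/-! ## Transfer to `X'` and the smooth fibre -/

section Fibration

variable {X : Scheme.{u}} (π : X ⟶ Proj (grading (Fin (d + 1 + 1)) k)) {P : Scheme.{u}}
  {b : P ⟶ Proj (grading (Fin (d + 1 + 1)) k)} {q : P ⟶ Proj (grading (Fin (d + 1)) k)}

/-- **Off the exceptional locus, smooth points of `pr ∘ π` are smooth points of `f`**: on
`φ⁻¹(X°)` one has `f = φ| ≫ (pr ∘ π)` with `φ|` an isomorphism (`b` a blowing up in the vertex),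
and the smooth locus is compatible with open immersions. [cite: DeJong1996, Lemma 4.11 (proof), p. 68] -/
theorem mem_smoothLocus_fibration_of_mem_offVertex
    {h : IsClosed ({vertex d k} : Set (Proj (grading (Fin (d + 1 + 1)) k)))}
    (hb : IsBlowup b (vanishingIdeal ⟨{vertex d k}, h⟩)) (hV : IsVertexProjection d k b q)
    [LocallyOfFinitePresentation (pullback.snd π b ≫ q)]
    [LocallyOfFinitePresentation (offVertexProjection d k π)]
    (w : ↥(pullback.fst π b ⁻¹ᵁ offVertex d k π))
    (hw : (pullback.fst π b ∣_ offVertex d k π) w ∈ (offVertexProjection d k π).smoothLocus) :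
    (pullback.fst π b ⁻¹ᵁ offVertex d k π).ι w ∈ (pullback.snd π b ≫ q).smoothLocus := by
  haveI := isIso_fst_morphismRestrict_offVertex d k π hb
  have hmem : ∀ (F F' : (↑(pullback.fst π b ⁻¹ᵁ offVertex d k π) : Scheme.{u}) ⟶ Proj (grading (Fin (d + 1)) k))
      (_ : F = F') [LocallyOfFinitePresentation F] [LocallyOfFinitePresentation F'] (y : ↥(pullback.fst π b ⁻¹ᵁ offVertex d k π)),
      y ∈ F.smoothLocus ↔ y ∈ F'.smoothLocus := by
    rintro F F' rfl _ _ y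
    exact Iff.rfl
  have h1 : w ∈ ((pullback.fst π b ⁻¹ᵁ offVertex d k π).ι ≫ pullback.snd π b ≫ q).smoothLocus ↔
      (pullback.fst π b ⁻¹ᵁ offVertex d k π).ι w ∈ (pullback.snd π b ≫ q).smoothLocus := by
    rw [← Scheme.Hom.preimage_smoothLocus_eq]; rfl
  have h2 : w ∈ ((pullback.fst π b ∣_ offVertex d k π) ≫ offVertexProjection d k π).smoothLocus ↔
      (pullback.fst π b ∣_ offVertex d k π) w ∈ (offVertexProjection d k π).smoothLocus := by
    rw [← Scheme.Hom.preimage_smoothLocus_eq]; rfl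
  exact h1.mp ((hmem _ _ (preimage_offVertex_ι_comp d k π hV) w).mpr (h2.mpr hw))

variable (fX : X ⟶ Spec (.of k))

/-- **A smooth fibre of `f`.** Let `b` be a blowing up of `ℙ^{d+1}` in the vertex (proper), `q`
its smooth projection to `ℙ^d` (`IsVertexProjection`, a `k`-morphism), `π : X → ℙ^{d+1}` finite
over `k` with `X` proper, étale over the open `V ∋ vertex`, and `y₀ ∈ ℙ^d` a closed point such
that `pr ∘ π : X° → ℙ^d` is smooth at every point of `X°` over `y₀` that is closed in `X`. Then
the fibre of `f = pr₂ ≫ q : X' = X ×_{ℙ^{d+1}} P̃ → ℙ^d` over `y₀` is smooth over `κ(y₀)`: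
every point of `X'` over `y₀` is a smooth point of `f` (closed points over the vertex by
`DeJong1996.mem_smoothLocus_of_apply_mem`, closed points off the vertex by the hypothesis,
the others by specialisation), and `f` is proper, so `f` is smooth over a neighbourhood of `y₀`.
[cite: DeJong1996, Lemma 4.11 (proof), p. 68; 4.12 (vi) c')] -/
theorem smooth_fiberToSpecResidueField_fibration [IsProper fX] [IsFinite π]
    {h : IsClosed ({vertex d k} : Set (Proj (grading (Fin (d + 1 + 1)) k)))}
    (hb : IsBlowup b (vanishingIdeal ⟨{vertex d k}, h⟩)) [IsProper b] (hV : IsVertexProjection d k b q)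
    [Smooth q] (hq : q ≫ toSpec (Fin (d + 1)) k = b ≫ toSpec (Fin (d + 1 + 1)) k)
    (V : (Proj (grading (Fin (d + 1 + 1)) k)).Opens) (hvV : vertex d k ∈ V) [Etale (π ∣_ V)]
    [LocallyOfFinitePresentation (offVertexProjection d k π)]
    (y₀ : Proj (grading (Fin (d + 1)) k)) (hy₀ : IsClosed ({y₀} : Set (Proj (grading (Fin (d + 1)) k))))
    (hB : ∀ x : ↥(offVertex d k π), IsClosed ({(offVertex d k π).ι x} : Set X) →
      offVertexProjection d k π x = y₀ → x ∈ (offVertexProjection d k π).smoothLocus) :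
    Smooth ((pullback.snd π b ≫ q).fiberToSpecResidueField y₀) := by
  haveI : IsProper (toSpec (Fin (d + 1)) k) := ProjSpace.isProper_over d k
  haveI : IsProper (toSpec (Fin (d + 1 + 1)) k) := ProjSpace.isProper_over (d + 1) k
  -- `f` is proper, `X'` compact
  haveI : IsProper (q ≫ toSpec (Fin (d + 1)) k) := by rw [hq]; infer_instance
  haveI : IsProper q := IsProper.of_comp q (toSpec (Fin (d + 1)) k)
  haveI : IsProper (pullback.snd π b ≫ q) := inferInstance
  haveI : IsLocallyNoetherian (Proj (grading (Fin (d + 1)) k)) :=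
    LocallyOfFiniteType.isLocallyNoetherian (toSpec (Fin (d + 1)) k)
  haveI : LocallyOfFinitePresentation (pullback.snd π b ≫ q) :=
    Descent45.Setup.locallyOfFinitePresentation_of_isLocallyNoetherian _
  haveI : CompactSpace ↥(pullback π b) :=
    QuasiCompact.compactSpace_of_compactSpace (pullback.fst π b ≫ fX)
  set f := pullback.snd π b ≫ q with hf
  -- every point over `y₀` is a smooth point
  have key : ∀ x' : ↥(pullback π b), f x' = y₀ → x' ∈ f.smoothLocus := by
    intro x' hx'
    -- a closed specialisation `x₁` of `x'`, still over `y₀`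
    obtain ⟨x₁, hx₁, hx₁c⟩ := (isClosed_closure (s := ({x'} : Set ↥(pullback π b)))).exists_closed_singleton
      ⟨x', subset_closure rfl⟩
    have hsp : x' ⤳ x₁ := specializes_iff_mem_closure.mpr hx₁
    have hfx₁ : f x₁ = y₀ := by
      have h1 : f x₁ ∈ closure {f x'} := specializes_iff_mem_closure.mp (hsp.map f.continuous)
      rwa [hx', hy₀.closure_eq, Set.mem_singleton_iff] at h1
    suffices hx₁s : x₁ ∈ f.smoothLocus from hsp.mem_open f.smoothLocus.isOpen hx₁s
    -- `x = φ(x₁)` is closed in `X`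
    have hxc : IsClosed ({pullback.fst π b x₁} : Set X) := by
      have := (pullback.fst π b).isClosedMap _ hx₁c
      rwa [Set.image_singleton] at this
    by_cases hv : π (pullback.fst π b x₁) = vertex d k
    · -- over the vertex: `π` étale there and `q` smooth
      exact mem_smoothLocus_of_apply_mem π b q V (show π (pullback.fst π b x₁) ∈ V by rwa [hv])
    · -- off the vertex: transfer to `pr ∘ π`
      have hx₀ : pullback.fst π b x₁ ∈ offVertex d k π := (mem_offVertex_iff d k π _).mpr hv
      let w : ↥(pullback.fst π b ⁻¹ᵁ offVertex d k π) := ⟨x₁, hx₀⟩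
      have hw : (pullback.fst π b ⁻¹ᵁ offVertex d k π).ι w = x₁ := rfl
      rw [← hw]
      refine mem_smoothLocus_fibration_of_mem_offVertex d π hb hV w (hB _ ?_ ?_)
      · have e1 : (offVertex d k π).ι ((pullback.fst π b ∣_ offVertex d k π) w) = pullback.fst π b x₁ := by
          rw [← Scheme.Hom.comp_apply, morphismRestrict_ι]; rfl
        rw [e1]; exact hxc
      · rw [← Scheme.Hom.comp_apply, ← preimage_offVertex_ι_comp d k π hV, Scheme.Hom.comp_apply]
        exact hfx₁
  obtain ⟨V', hy₀V', hsm⟩ :=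
    Literature.AlgebraicGeometry.Morphisms.exists_smooth_morphismRestrict_of_forall_mem_smoothLocus f key
  haveI := hsm
  exact smooth_fiberToSpecResidueField_of_mem f V' hy₀V'

end Fibration

end DeJong1996

end Literature.AlgebraicGeometry.Resolution

end
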